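import Literature.NumberTheory.GaloisRepresentations.CompletionCompositumEmbeddingTower
import Literature.NumberTheory.GaloisRepresentations.IdeleLocalInvariantsConjugation
import Literature.NumberTheory.GaloisRepresentations.RamificationFiltration
import HarnessLib

/-!
# Brick (c) at `p = 2`, module M-DEPL (places): under the item's coset completeness (H1) the distinguished place `𝔓_{n'}` of `S_{n'}` is the ONLY place of
# `S_{n'}` above `𝔓_n` — the hypothesis `huniq` of `…BrickCD4ChiNormIntertwine` (de Shalit II.1.10: the primes above `𝔭` are finitely decomposed in `K(𝔣𝔭^∞)`)

Cell `bsd-print-cf2`, width seat `bsd-line-cf2c-w7` g28, route C `PrintCf2RubinValueTwo`, crux of record stmt-BirchSwinnertonDyer-24033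
`TwoVariableMainConjAtSplitTwoQuad` (23720 nominal), BRICK §4(c); memo v8 `Cruxes/TwoVariableMainConjAtSplitTwoQuad/BRICK-C-D4CHI-g28.md` §2 (D7/I2).
`--supports` the crux as a helper.  For a monotone tower `F_n ⊆ K̄` of finite Galois layers and coset data `t : J → Γ_K` such that, at two levels `n ≤ n'`,
`j ↦ t_j·𝔓_m` (`𝔓_m = embPlace v (F m)`, the place cut out by the fixed embedding `K̄ → K̄_v`) is a BIJECTION onto the places of `F_m` above `v` (the item's (H1)):

* `restrictNormal_absRestrictNormalHom` — `(σ|_{F_{n'}})|_{F_n} = σ|_{F_n}`; `under_absRestrictNormalHom_smul` — `(σ|_{F_{n'}}·w) ∩ F_n = σ|_{F_n}·(w ∩ F_n)`.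
* ★★ `place_eq_embPlaceOver_of_coset_bijective` — **every place of `F_{n'}` above `𝔓_n` is `𝔓_{n'}`**: it is `t_j𝔓_{n'}` for some `j` (surjectivity at `n'`),
  restricts to `t_j𝔓_n = 𝔓_n`, and `𝔓_{n'} = t_{j₀}𝔓_{n'}` with `t_{j₀}𝔓_n = 𝔓_n` as well, so `j = j₀` (injectivity at `n`).
THEOREMS ONLY (0 sorry, no definition, no named fact).  BSD is not proved by any of this; nothing here closes 24033 or 27037.

## References
* [deShalit1987] E. de Shalit, *Iwasawa theory of elliptic curves with complex multiplication* (1987), II.1.10 (p. 39), II.4.1 (3), III.1.1–1.2.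
* [CasselsFrohlichANT1967] J. W. S. Cassels, A. Fröhlich (eds.), *Algebraic Number Theory* (1967), Ch. II §10, Ch. VII §1.1 (the action of `G` on the primes).
-/

noncomputable section

set_option linter.dupNamespace false
set_option autoImplicit false

open scoped NumberField Classical

namespace Summit.BirchSwinnertonDyer.BirchSwinnertonDyer.Theorems.PrintCf2.BrickCD4Chi

open Field IsDedekindDomain IsDedekindDomain.HeightOneSpectrum
open Literature.NumberTheory.GaloisRepresentations

variable {K : Type} [Field K] [NumberField K] (v : HeightOneSpectrum (𝓞 K))
  {L L' : IntermediateField K (AlgebraicClosure K)} (hLL' : L ≤ L')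

omit [NumberField K] in
/-- `L → L' → K̄` is a scalar tower for `towerAlgebra` (both maps are inclusions). [folklore] -/
private theorem isScalarTower_towerAlgebra_top :
    letI := LocalWeilDatum.towerAlgebra hLL'
    IsScalarTower L L' (AlgebraicClosure K) :=
  letI := LocalWeilDatum.towerAlgebra hLL'
  IsScalarTower.of_algebraMap_eq fun _ ↦ rfl

omit [NumberField K] in
/-- `(σ|_{L'})|_{L} = σ|_{L}` for `σ ∈ Γ_K` and normal `L ≤ L'` (restriction in stages). [cite: CasselsFrohlichANT1967, Ch. VII §1.1] -/
theorem restrictNormal_absRestrictNormalHom [Normal K L] [Normal K L'] (σ : absoluteGaloisGroup K) :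
    letI := LocalWeilDatum.towerAlgebra hLL'
    (absRestrictNormalHom L' σ).restrictNormal L = absRestrictNormalHom L σ := by
  letI := LocalWeilDatum.towerAlgebra hLL'
  haveI := SemiLocal.isScalarTower_towerAlgebra L L' hLL'
  haveI := isScalarTower_towerAlgebra_top hLL'
  change AlgEquiv.restrictNormalHom L (AlgEquiv.restrictNormalHom L' (absoluteGaloisGroup.toAlgEquiv K σ)) =
    AlgEquiv.restrictNormalHom L (absoluteGaloisGroup.toAlgEquiv K σ)
  exact (IsScalarTower.AlgEquiv.restrictNormalHom_comp_apply L L' (absoluteGaloisGroup.toAlgEquiv K σ)).symm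

omit [NumberField K] in
/-- `(σ|_{L'}·w) ∩ 𝓞_L = σ|_L·(w ∩ 𝓞_L)` for a place `w` of `L'` (`L ≤ L'` normal over `K`). [cite: CasselsFrohlichANT1967, Ch. VII §1.1] -/
theorem under_absRestrictNormalHom_smul [NumberField L] [NumberField L'] [Normal K L] [Normal K L'] (σ : absoluteGaloisGroup K)
    (w : HeightOneSpectrum (𝓞 L')) :
    letI := LocalWeilDatum.towerAlgebra hLL'
    ((absRestrictNormalHom L' σ) • w).under (𝓞 L) = (absRestrictNormalHom L σ) • w.under (𝓞 L) := by
  letI := LocalWeilDatum.towerAlgebra hLL'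
  haveI := SemiLocal.isScalarTower_towerAlgebra L L' hLL'
  rw [IdeleCohomology.under_algEquiv_smul_restrictNormal, restrictNormal_absRestrictNormalHom hLL']

/-- ★★ **Under coset completeness at levels `n ≤ n'`, `𝔓_{n'}` is the only place of `F_{n'}` above `𝔓_n`.**  `F` a monotone tower of finite Galois layers,
`t : J → Γ_K` with `j ↦ t_j·𝔓_{F_m}` SURJECTIVE onto the places above `v` at `m = n'` and INJECTIVE at `m = n`: every `w' ∣ 𝔓_n` equals `embPlaceOver`
(the hypothesis `huniq` of `…BrickCD4ChiNormIntertwine.norm_readout_twistedUnit_eq`). [cite: deShalit1987, II.1.10 (p. 39), III.1.1–1.2]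
[cite: CasselsFrohlichANT1967, Ch. VII §1.1] -/
theorem place_eq_embPlaceOver_of_coset_bijective [NumberField L] [NumberField L'] [IsGalois K L] [IsGalois K L']
    {J : Type} (t : J → absoluteGaloisGroup K)
    (hinj : Function.Injective fun j : J ↦ absRestrictNormalHom L (t j) • (SemiLocal.embPlace v L.val : SemiLocal.Place K L v))
    (hsurj : Function.Surjective fun j : J ↦ absRestrictNormalHom L' (t j) • (SemiLocal.embPlace v L'.val : SemiLocal.Place K L' v)) :
    letI := LocalWeilDatum.towerAlgebra hLL'
    ∀ w' : SemiLocal.Place L L' ((SemiLocal.embPlace v L.val : SemiLocal.Place K L v) : HeightOneSpectrum (𝓞 L)),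
      w' = SemiLocal.embPlaceOver v L L' hLL' := by
  letI := LocalWeilDatum.towerAlgebra hLL'
  haveI := SemiLocal.isScalarTower_towerAlgebra L L' hLL'
  intro w'
  -- `w'` as a place of `L'` above `v`
  have h1 : ((w' : HeightOneSpectrum (𝓞 L')).under (𝓞 L)).under (𝓞 K) = (w' : HeightOneSpectrum (𝓞 L')).under (𝓞 K) :=
    HeightOneSpectrum.ext (Ideal.under_under (A := 𝓞 K) (B := 𝓞 L) (w' : HeightOneSpectrum (𝓞 L')).asIdeal)
  have hw'v : (w' : HeightOneSpectrum (𝓞 L')).under (𝓞 K) = v := by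
    rw [← h1, w'.under_eq]
    exact (SemiLocal.embPlace v L.val : SemiLocal.Place K L v).under_eq
  obtain ⟨j, hj⟩ := hsurj ⟨(w' : HeightOneSpectrum (𝓞 L')), hw'v⟩
  -- the index of the stabiliser coset of `𝔓_{n'}`
  obtain ⟨j₀, hj₀⟩ := hsurj (SemiLocal.embPlace v L'.val)
  have hj' : absRestrictNormalHom L' (t j) • ((SemiLocal.embPlace v L'.val : SemiLocal.Place K L' v) : HeightOneSpectrum (𝓞 L')) = w' :=
    congrArg SemiLocal.Place.val hj
  have hj₀' : absRestrictNormalHom L' (t j₀) • ((SemiLocal.embPlace v L'.val : SemiLocal.Place K L' v) : HeightOneSpectrum (𝓞 L')) =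
      (SemiLocal.embPlace v L'.val : SemiLocal.Place K L' v) :=
    congrArg SemiLocal.Place.val hj₀
  -- both `t_j` and `t_{j₀}` fix `𝔓_n`
  have hPn : ∀ i : J, absRestrictNormalHom L' (t i) • ((SemiLocal.embPlace v L'.val : SemiLocal.Place K L' v) : HeightOneSpectrum (𝓞 L')) = w' ∨
      absRestrictNormalHom L' (t i) • ((SemiLocal.embPlace v L'.val : SemiLocal.Place K L' v) : HeightOneSpectrum (𝓞 L')) =
        (SemiLocal.embPlace v L'.val : SemiLocal.Place K L' v) →
      absRestrictNormalHom L (t i) • (SemiLocal.embPlace v L.val : SemiLocal.Place K L v) = SemiLocal.embPlace v L.val := by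
    intro i hi
    apply SemiLocal.Place.ext
    rw [SemiLocal.Place.coe_smul]
    have hunder : ∀ w₁ : HeightOneSpectrum (𝓞 L'), w₁.under (𝓞 L) = (SemiLocal.embPlace v L.val : SemiLocal.Place K L v) →
        (absRestrictNormalHom L' (t i) • ((SemiLocal.embPlace v L'.val : SemiLocal.Place K L' v) : HeightOneSpectrum (𝓞 L'))) = w₁ →
        absRestrictNormalHom L (t i) • ((SemiLocal.embPlace v L.val : SemiLocal.Place K L v) : HeightOneSpectrum (𝓞 L)) =
          (SemiLocal.embPlace v L.val : SemiLocal.Place K L v) := by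
      intro w₁ hw₁ he
      have e : ((absRestrictNormalHom L' (t i) • ((SemiLocal.embPlace v L'.val : SemiLocal.Place K L' v) : HeightOneSpectrum (𝓞 L')))).under (𝓞 L) =
          w₁.under (𝓞 L) := by rw [he]
      rw [under_absRestrictNormalHom_smul hLL', SemiLocal.under_embPlace_eq v L L' hLL'] at e
      rw [e, hw₁]
    rcases hi with hi | hi
    · exact hunder _ w'.under_eq hi
    · exact hunder _ (SemiLocal.under_embPlace_eq v L L' hLL') hi
  have e : j = j₀ := hinj ((hPn j (Or.inl hj')).trans (hPn j₀ (Or.inr hj₀')).symm)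
  subst e
  apply SemiLocal.Place.ext
  rw [← hj', hj₀']
  rfl

end Summit.BirchSwinnertonDyer.BirchSwinnertonDyer.Theorems.PrintCf2.BrickCD4Chi

end
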